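import Literature.Geometry.Kaehler.ChartWindowCore
import Literature.Geometry.Kaehler.LimitConeCharts
import Literature.Geometry.Kaehler.OrthoChartEstimates
import HarnessLib

/-!
# Chart windows of the tangent cone: windows at the regular directions of the limit cone

The chart-window files (`ChartWindow.lean`, …, `ChartWindowCore.lean`) compute the blow-ups
`D_r = (1/r)_*(τ_{-b})_*[T]` of a holomorphic `p`-chain `T` inside a chart window `W` under the
standing hypothesis that, for `0 < r < r₀`, the pulled-back carrier `A_r⁻¹(reg|T|)` is vertically
`τ/16`-close to the graph of the window inside its closed tube. This file PRODUCES such windows at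
every regular direction of the tangent cone, i.e. at every point `y` of the regular part
`M = limitConeReg |T| hb p` of the limit cone `F = limitCone |T| hb` of the support of `T` at `b`
([Chirka1989, §8.1]: `F ⊇` all limits of blow-up directions; `AnalyticSetDeformation.lean`,
`LimitConeStructure.lean`):

* (private complements to the window API: the closed tube is closed, `{‖k‖ < s, ‖w‖ < η}` is
  open, the centre lies in the cores when the chart passes through it, graph points have `w = 0`);
* `HolomorphicChain.eventually_blowUpSet_inter_closedTube_subset` — **the eventual tube
  condition**: if the closed tube of `W` lies in `𝐁(0,1)` and the limit cone meets the closed tube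
  only in graph points (`w = 0`), then for every `η > 0` and all small `r > 0`,
  `A_r⁻¹(reg|T|) ∩ closedTube ⊆ {‖w‖ < η}` (the blown-up supports converge to the limit cone,
  `HolomorphicChain.eventually_forall_mem_of_blowUp`); `…_exists_forall_Ioo` — the form
  `∃ r₀ > 0, ∀ r ∈ (0, r₀), … ⊆ {‖w‖ < τ/16}` consumed by `ChartWindowSheets.lean` /
  `ChartWindowCore.lean`;
* `HolomorphicChain.exists_chartWindow_of_mem_limitConeReg` — **windows at the regular directions
  of the tangent cone**: for `y ∈ M` and `ε > 0` there is a chart window `W` centred at `y` over the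
  tangent plane `K = T_y F` (`dim_ℂ K = p`), built from the orthogonally normalised chart of the unit
  tangent-cone chain (`HolomorphicChain.exists_orthoChart_tangent`, `LimitConeCharts.lean`) at an
  almost-isometric radius (`OrthoChart.exists_radius`: `‖DΨ − ι_K‖ ≤ 1/2`, so `‖DΨ‖ ≤ 2`), with
  `τ ≤ (a₁² − a₂²)/(2ρ)` (the hypothesis of `ChartWindowLipschitz.lean`), closed tube inside
  `𝐁(y, ε)`, `y` in the open core, `Ψ(ball 0 ρ) ⊆ F`, and `F ∩ closedTube ⊆ Ψ(ball 0 ρ)` — so the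
  limit cone meets the tube only in graph points and the eventual tube condition holds;
* `HolomorphicChain.exists_chartWindow_sheets_of_mem_limitConeReg` — the same packaged with
  `closedTube ⊆ 𝐁(0, ρ₀)` (`‖y‖ < ρ₀ < 1`) and the `τ/16`-tube condition on an interval `(0, r₀)`:
  exactly the data under which `HolomorphicChain.exists_sheetNumber` and
  `HolomorphicChain.collapse_pushforward_corePiece` apply. Thus **the sheet number of the blow-ups
  of `T` over every regular direction of its tangent cone is defined** — the multiplicity of the
  tangent cone there (King's theorem, `Literature.Geometry.Kaehler.King1971_tangentCone`,
  [Harvey1977, Thm. 1.31]; [Federer1969, 4.3.18]).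

Theorems only; no definitions, no named facts.

## References

* H. Federer, *Geometric Measure Theory*, Springer 1969, 4.3.16–4.3.19 [Federer1969].
* R. Harvey, *Holomorphic chains and their boundaries*, PSPUM XXX.1 (1977), §1.10, Thm. 1.31
  [Harvey1977].
* E. M. Chirka, *Complex Analytic Sets*, Kluwer 1989, §2.3, §8.1 [Chirka1989].
* J. R. King, *The currents defined by analytic varieties*, Acta Math. 127 (1971), §5.
-/

noncomputable section

open scoped Manifold Topology ENNReal NNReal
open Set Filter MeasureTheory Metric Function Module TopologicalSpace

namespace Literature.Geometry.Kaehler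

open Literature.Geometry.GeometricMeasureTheory

universe u

variable {V : Type u} [NormedAddCommGroup V] [InnerProductSpace ℂ V] [FiniteDimensional ℂ V]

/-! ### Complements to the window API -/

namespace ChartWindow

variable (W : ChartWindow V)

/-- The closed tube of a window is closed. [folklore] -/
private theorem isClosed_closedTube : IsClosed W.closedTube := W.isClosed_sublevel W.a₁_lt

/-- The set `{‖k‖ < s, ‖w‖ < η}`, `s ≤ ρ`, is open (the displacement `w` is continuous on the
chart domain). [folklore] -/
private theorem isOpen_norm_kf_lt_inter_norm_wf_lt {s η : ℝ} (hs : s ≤ W.ρ) :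
    IsOpen {x : V | ‖W.kf x‖ < s ∧ ‖W.wf x‖ < η} := by
  have h1 : IsOpen {x : V | ‖W.kf x‖ < s} :=
    isOpen_lt (continuous_norm.comp W.contDiff_kf.continuous) continuous_const
  have h2 : IsOpen ({x : V | ‖W.kf x‖ < W.ρ} ∩ W.wf ⁻¹' ball (0 : V) η) :=
    W.contDiffOn_wf.continuousOn.isOpen_inter_preimage W.isOpen_chartDomain isOpen_ball
  have : {x : V | ‖W.kf x‖ < s ∧ ‖W.wf x‖ < η} =
      {x : V | ‖W.kf x‖ < s} ∩ ({x : V | ‖W.kf x‖ < W.ρ} ∩ W.wf ⁻¹' ball (0 : V) η) := by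
    ext x
    simp only [mem_setOf_eq, mem_inter_iff, mem_preimage, mem_ball_zero_iff]
    exact ⟨fun h => ⟨h.1, h.1.trans_le hs, h.2⟩, fun h => ⟨h.1, h.2.2⟩⟩
  rw [this]
  exact h1.inter h2

/-- `k(m) = 0`. [folklore] -/
@[simp] private theorem kf_center : W.kf W.m = 0 := by simp [kf]

/-- If the chart passes through the centre, `w(m) = 0`. [folklore] -/
private theorem wf_center (h0 : W.Ψ 0 = W.m) : W.wf W.m = 0 := by
  simp [wf, h0]

/-- If the chart passes through the centre, the centre lies in the open core. [folklore] -/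
private theorem center_mem_coreOpen (h0 : W.Ψ 0 = W.m) : W.m ∈ W.coreOpen := by
  refine ⟨?_, ?_⟩
  · rw [W.kf_center, norm_zero]; exact W.a₂_pos
  · rw [W.wf_center h0, norm_zero]; linarith [W.τ_pos]

/-- If the chart passes through the centre, the centre lies in the inner core. [folklore] -/
private theorem center_mem_innerCore (h0 : W.Ψ 0 = W.m) : W.m ∈ W.innerCore := by
  refine ⟨?_, ?_⟩
  · rw [W.kf_center, norm_zero]; exact W.a₃_pos
  · rw [W.wf_center h0, norm_zero]; linarith [W.τ_pos]

/-- Graph points have no vertical displacement. [folklore] -/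
private theorem wf_eq_zero_of_mem_image {x : V} (hx : x ∈ W.Ψ '' ball (0 : W.K) W.ρ) : W.wf x = 0 := by
  obtain ⟨k, hk, rfl⟩ := hx
  exact W.wf_chart hk

/-- The closed tube lies in the chart domain. [folklore] -/
private theorem norm_kf_lt_of_mem_closedTube {x : V} (hx : x ∈ W.closedTube) : ‖W.kf x‖ < W.ρ :=
  lt_of_le_of_lt hx.1 W.a₁_lt

end ChartWindow

/-! ### The eventual tube condition -/

namespace HolomorphicChain

variable {Ω : Opens V} {p : ℕ}

/-- **The eventual tube condition.** If the closed tube of the window `W` lies in `𝐁(0,1)` and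
the limit cone `F` of `|T|` at `b` meets the closed tube only in points with `w = 0`, then for every
`η > 0`, for all sufficiently small `r > 0`, the pulled-back carrier satisfies
`A_r⁻¹(reg|T|) ∩ closedTube ⊆ {‖w‖ < η}`: apply the convergence of the blown-up supports to the
limit cone (`eventually_forall_mem_of_blowUp`) to the open set
`U = closedTubeᶜ ∪ {‖k‖ < ρ, ‖w‖ < η} ⊇ F ∩ 𝐁(0,1)`. [cite: Federer1969, 4.3.16; Chirka1989, §8.1 Prop. 1] -/
theorem eventually_blowUpSet_inter_closedTube_subset (T : HolomorphicChain 𝓘(ℂ, V) Ω p) {b : V}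
    (hb : b ∈ (Ω : Set V)) (W : ChartWindow V) (hW1 : W.closedTube ⊆ closedBall (0 : V) 1)
    (hFW : ∀ x ∈ limitCone T.support hb ∩ W.closedTube, W.wf x = 0) {η : ℝ} (hη : 0 < η) :
    ∀ᶠ r in 𝓝[>] (0 : ℝ), T.blowUpSet b r ∩ W.closedTube ⊆ {x | ‖W.wf x‖ < η} := by
  set U : Set V := W.closedTubeᶜ ∪ {x : V | ‖W.kf x‖ < W.ρ ∧ ‖W.wf x‖ < η} with hU
  have hUo : IsOpen U :=
    W.isClosed_closedTube.isOpen_compl.union (W.isOpen_norm_kf_lt_inter_norm_wf_lt le_rfl)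
  have hFU : limitCone T.support hb ∩ closedBall (0 : V) 1 ⊆ U := by
    rintro x ⟨hxF, -⟩
    by_cases hxT : x ∈ W.closedTube
    · refine Or.inr ⟨W.norm_kf_lt_of_mem_closedTube hxT, ?_⟩
      rw [hFW x ⟨hxF, hxT⟩, norm_zero]
      exact hη
    · exact Or.inl hxT
  filter_upwards [T.eventually_forall_mem_of_blowUp hb hUo hFU] with r hr
  rintro x ⟨hxA, hxT⟩
  have hx1 : x ∈ closedBall (0 : V) 1 := hW1 hxT
  have hxs : b + r • x ∈ ((↑) : Ω → V) '' T.support := T.carrier_subset_image_support hxA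
  rcases hr x hx1 hxs with hxU | hxU
  · exact absurd hxT hxU
  · exact hxU.2

/-- The eventual tube condition in interval form, at width `τ/16`: there is `r₀ > 0` with
`A_r⁻¹(reg|T|) ∩ closedTube ⊆ {‖w‖ < τ/16}` for all `0 < r < r₀` — the standing hypothesis of
`ChartWindowSheets.lean` / `ChartWindowCore.lean`. [cite: Federer1969, 4.3.16] -/
theorem exists_forall_Ioo_blowUpSet_inter_closedTube_subset (T : HolomorphicChain 𝓘(ℂ, V) Ω p)
    {b : V} (hb : b ∈ (Ω : Set V)) (W : ChartWindow V) (hW1 : W.closedTube ⊆ closedBall (0 : V) 1)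
    (hFW : ∀ x ∈ limitCone T.support hb ∩ W.closedTube, W.wf x = 0) :
    ∃ r₀ : ℝ, 0 < r₀ ∧
      ∀ r ∈ Ioo 0 r₀, T.blowUpSet b r ∩ W.closedTube ⊆ {x | ‖W.wf x‖ < W.τ / 16} := by
  have h := T.eventually_blowUpSet_inter_closedTube_subset hb W hW1 hFW
    (η := W.τ / 16) (by linarith [W.τ_pos])
  obtain ⟨r₀, hr₀, h⟩ := (nhdsGT_basis (0 : ℝ)).eventually_iff.1 h
  refine ⟨r₀, hr₀, fun r hr => h ?_⟩
  simpa only [zero_add] using hr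

/-- The eventual tube condition in interval form with a prescribed radius bound `r₀ ≤ R`.
[cite: Federer1969, 4.3.16] -/
theorem exists_forall_Ioo_blowUpSet_inter_closedTube_subset_of_lt (T : HolomorphicChain 𝓘(ℂ, V) Ω p)
    {b : V} (hb : b ∈ (Ω : Set V)) (W : ChartWindow V) (hW1 : W.closedTube ⊆ closedBall (0 : V) 1)
    (hFW : ∀ x ∈ limitCone T.support hb ∩ W.closedTube, W.wf x = 0) {R : ℝ} (hR : 0 < R) :
    ∃ r₀ : ℝ, 0 < r₀ ∧ r₀ ≤ R ∧
      ∀ r ∈ Ioo 0 r₀, T.blowUpSet b r ∩ W.closedTube ⊆ {x | ‖W.wf x‖ < W.τ / 16} := by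
  obtain ⟨r₀, hr₀, h⟩ := T.exists_forall_Ioo_blowUpSet_inter_closedTube_subset hb W hW1 hFW
  exact ⟨min r₀ R, lt_min hr₀ hR, min_le_right _ _,
    fun r hr => h r ⟨hr.1, hr.2.trans_le (min_le_left _ _)⟩⟩

/-! ### Windows at the regular directions of the tangent cone -/

/-- Near a point of `M`, the limit cone consists of points of `M`: the set of regular points of
codimension `dim V − p` is open. [cite: Chirka1989, §2.3] -/
theorem isOpen_setOf_isRegularPointOfCodim_limitConeTop (A : Set Ω) {b : V} (hb : b ∈ (Ω : Set V))
    (p : ℕ) :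
    IsOpen {x : V | IsRegularPointOfCodim 𝓘(ℂ, V) (limitConeTop A hb) (finrank ℂ V - p)
      (⟨x, trivial⟩ : (⊤ : Opens V))} :=
  (isOpen_setOf_isRegularPointOfCodim (I := 𝓘(ℂ, V)) (limitConeTop A hb) (finrank ℂ V - p)).preimage
    (Continuous.subtype_mk continuous_id _)

omit [FiniteDimensional ℂ V] in
/-- `‖ι_K‖ ≤ 1` for the inclusion of a subspace. [folklore] -/
private theorem norm_subtypeL_le (K : Submodule ℂ V) : ‖K.subtypeL‖ ≤ 1 :=
  ContinuousLinearMap.opNorm_le_bound _ zero_le_one fun k => by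
    rw [one_mul, Submodule.subtypeL_apply, Submodule.coe_norm]

/-- **Chart windows at the regular directions of the tangent cone.** Let `T` be a holomorphic
`p`-chain with support of pure dimension `p`, `b ∈ Ω`, `F = limitCone |T| hb` its limit cone at `b`
and `y ∈ M = limitConeReg |T| hb p` a regular point of `F` of dimension `p`. For every `ε > 0` there
is a chart window `W` centred at `y` over the tangent plane `K = T_y F` (`dim_ℂ K = p`) whose chart
`Ψ` is the orthogonally normalised chart of the unit tangent-cone chain at `y` (`Ψ 0 = y`,
`DΨ(0) = ι_K`) at an almost-isometric radius (`‖DΨ − ι_K‖ ≤ 1/2`, `‖DΨ‖ ≤ 2` on `ball 0 ρ`), with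
radii `a₁ = ρ/2`, `a₂ = ρ/4`, `a₃ = ρ/8`, width `τ = ρ/16 ≤ (a₁² − a₂²)/(2ρ)`, closed tube inside
`𝐁(y, ε)`, `y` in the inner core, graph inside the limit cone and **limit cone inside the tube equal to
graph points** (`F ∩ closedTube ⊆ Ψ(ball 0 ρ)`, so `w = 0` there).
[cite: Federer1969, 4.3.18; Chirka1989, §2.3, §8.1] -/
theorem exists_chartWindow_of_mem_limitConeReg [MeasurableSpace V] [BorelSpace V] (T : HolomorphicChain 𝓘(ℂ, V) Ω p)
    (hA : HasPureDim 𝓘(ℂ, V) T.support p) {b : V} (hb : b ∈ (Ω : Set V)) {y : (⊤ : Opens V)}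
    (hy : y ∈ limitConeReg T.support hb p) {ε : ℝ} (hε : 0 < ε) :
    ∃ W : ChartWindow V, W.m = y ∧ finrank ℂ W.K = p ∧ W.Ψ 0 = y ∧
      fderiv ℂ W.Ψ 0 = W.K.subtypeL ∧
      (∀ k ∈ ball (0 : W.K) W.ρ, ‖fderiv ℂ W.Ψ k - W.K.subtypeL‖ ≤ 1 / 2) ∧
      (∀ k ∈ ball (0 : W.K) W.ρ, ‖fderiv ℂ W.Ψ k‖ ≤ 2) ∧
      W.a₁ = W.ρ / 2 ∧ W.a₂ = W.ρ / 4 ∧ W.a₃ = W.ρ / 8 ∧ W.τ = W.ρ / 16 ∧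
      W.τ ≤ (W.a₁ ^ 2 - W.a₂ ^ 2) / (2 * W.ρ) ∧
      W.closedTube ⊆ closedBall (y : V) ε ∧
      (y : V) ∈ W.innerCore ∧ (y : V) ∈ W.coreOpen ∧
      (∀ k ∈ ball (0 : W.K) W.ρ, W.Ψ k ∈ (limitConeUnitChain hA hb).carrier) ∧
      W.Ψ '' ball (0 : W.K) W.ρ ⊆ limitCone T.support hb ∧
      (∀ k ∈ ball (0 : W.K) W.ρ,
        approxTangentCone (2 * p) ((μHE[2 * p] : Measure V).restrict
          (limitConeUnitChain hA hb).carrier) (W.Ψ k) = Set.range (fderiv ℂ W.Ψ k)) ∧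
      limitCone T.support hb ∩ W.closedTube ⊆ W.Ψ '' ball (0 : W.K) W.ρ ∧
      (∀ x ∈ limitCone T.support hb ∩ W.closedTube, W.wf x = 0) := by
  -- the orthogonally normalised chart of the unit tangent-cone chain at `y`
  set C₁ := limitConeUnitChain hA hb with hC₁
  have hyc : (y : V) ∈ C₁.carrier := mem_carrier_limitConeUnitChain hA hb hy
  obtain ⟨K, ρ, Ψ, N, hKp, hρ, hNo, hyN, -, hΨd, hΨ0, hDΨ, hproj, hΨcar, hcarN, htan, -⟩ :=
    C₁.exists_orthoChart_tangent hyc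
  -- near `y` the limit cone consists of regular points of dimension `p`, hence of carrier points
  set N' : Set V := N ∩ {x : V | IsRegularPointOfCodim 𝓘(ℂ, V) (limitConeTop T.support hb)
    (finrank ℂ V - p) (⟨x, trivial⟩ : (⊤ : Opens V))} with hN'
  have hN'o : IsOpen N' := hNo.inter (isOpen_setOf_isRegularPointOfCodim_limitConeTop _ hb p)
  have hyN' : (y : V) ∈ N' := ⟨hyN, (mem_limitConeReg_iff.1 hy).2⟩
  have hFN' : limitCone T.support hb ∩ N' ⊆ Ψ '' ball (0 : K) ρ := by
    rintro x ⟨hxF, hxN, hxreg⟩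
    have hx' : (⟨x, trivial⟩ : (⊤ : Opens V)) ∈ limitConeReg T.support hb p :=
      mem_limitConeReg_iff.2 ⟨hxF, hxreg⟩
    exact hcarN ⟨mem_carrier_limitConeUnitChain hA hb hx', hxN⟩
  -- an almost-isometric radius and a radius inside `N'`
  obtain ⟨r₁, hr₁, hr₁ρ, hD⟩ := OrthoChart.exists_radius hΨd hρ hDΨ (ε := 1 / 2) (by norm_num)
  obtain ⟨δ, hδ, hδN'⟩ := nhds_basis_closedBall.mem_iff.1 (hN'o.mem_nhds hyN')
  set s : ℝ := min r₁ (min δ ε) with hs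
  have hs0 : 0 < s := lt_min hr₁ (lt_min hδ hε)
  have hsr₁ : s ≤ r₁ := min_le_left _ _
  have hsδ : s ≤ δ := (min_le_right _ _).trans (min_le_left _ _)
  have hsε : s ≤ ε := (min_le_right _ _).trans (min_le_right _ _)
  have hsρ : s ≤ ρ := hsr₁.trans hr₁ρ
  -- the window
  let W : ChartWindow V :=
    { K := K, m := y, Ψ := Ψ, ρ := s, a₁ := s / 2, a₂ := s / 4, a₃ := s / 8, τ := s / 16
      a₃_pos := by positivity
      a₃_lt := by linarith
      a₂_lt := by linarith
      a₁_lt := by linarith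
      τ_pos := by positivity
      differentiableOn := hΨd.mono (ball_subset_ball hsρ)
      proj_eq := fun k hk => hproj k (ball_subset_ball hsρ hk) }
  have hWs : W.ρ = s := rfl
  have hD' : ∀ k ∈ ball (0 : W.K) W.ρ, ‖fderiv ℂ W.Ψ k - W.K.subtypeL‖ ≤ 1 / 2 := fun k hk =>
    hD k (ball_subset_ball hsr₁ hk)
  have hM : ∀ k ∈ ball (0 : W.K) W.ρ, ‖fderiv ℂ W.Ψ k‖ ≤ 2 := by
    intro k hk
    have h1 := hD' k hk
    have h2 := norm_subtypeL_le K
    calc ‖fderiv ℂ Ψ k‖ = ‖(fderiv ℂ Ψ k - K.subtypeL) + K.subtypeL‖ := by rw [sub_add_cancel]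
      _ ≤ ‖fderiv ℂ Ψ k - K.subtypeL‖ + ‖K.subtypeL‖ :=
          norm_add_le (fderiv ℂ Ψ k - K.subtypeL) K.subtypeL
      _ ≤ 1 / 2 + 1 := add_le_add h1 h2
      _ ≤ 2 := by norm_num
  -- the closed tube lies in `𝐁(y, 13 s / 16)`
  have htube : W.closedTube ⊆ closedBall (y : V) (13 * s / 16) := by
    intro x hx
    have hk : ‖W.kf x‖ ≤ s / 2 := hx.1
    have hw : ‖W.wf x‖ ≤ s / 16 := hx.2
    have hkb : W.kf x ∈ ball (0 : K) r₁ := mem_ball_zero_iff.2 (by linarith)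
    have h0b : (0 : K) ∈ ball (0 : K) r₁ := mem_ball_self hr₁
    have hΨk : ‖Ψ (W.kf x) - (y : V)‖ ≤ (1 + 1 / 2) * ‖W.kf x - 0‖ := by
      rw [← hΨ0]
      exact OrthoChart.norm_sub_le hΨd hr₁ρ hD hkb h0b
    rw [sub_zero] at hΨk
    rw [mem_closedBall, dist_eq_norm]
    have hdec : x - (y : V) = W.wf x + (Ψ (W.kf x) - (y : V)) := by
      simp only [ChartWindow.wf]; abel
    calc ‖x - (y : V)‖ = ‖W.wf x + (Ψ (W.kf x) - (y : V))‖ := by rw [hdec]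
      _ ≤ ‖W.wf x‖ + ‖Ψ (W.kf x) - (y : V)‖ := norm_add_le _ _
      _ ≤ s / 16 + (1 + 1 / 2) * (s / 2) :=
          add_le_add hw (hΨk.trans (mul_le_mul_of_nonneg_left hk (by norm_num)))
      _ = 13 * s / 16 := by ring
  -- the limit cone inside the tube is the graph
  have hFW : limitCone T.support hb ∩ W.closedTube ⊆ W.Ψ '' ball (0 : W.K) W.ρ := by
    rintro x ⟨hxF, hxT⟩
    have hxN' : x ∈ N' := hδN' ((closedBall_subset_closedBall (by linarith)) (htube hxT))
    obtain ⟨k', hk', rfl⟩ := hFN' ⟨hxF, hxN'⟩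
    refine ⟨k', mem_ball_zero_iff.2 ?_, rfl⟩
    have hkf : W.kf (Ψ k') = k' := by
      simp only [ChartWindow.kf]
      exact hproj k' hk'
    have : ‖W.kf (Ψ k')‖ ≤ s / 2 := hxT.1
    rw [hkf] at this
    show ‖k'‖ < s
    linarith
  have hFW0 : ∀ x ∈ limitCone T.support hb ∩ W.closedTube, W.wf x = 0 := fun x hx =>
    W.wf_eq_zero_of_mem_image (hFW hx)
  refine ⟨W, rfl, hKp, hΨ0, hDΨ, hD', hM, rfl, rfl, rfl, rfl, ?_,
    htube.trans (closedBall_subset_closedBall (by linarith)), ?_, ?_, ?_, ?_, ?_, hFW, hFW0⟩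
  · -- `τ ≤ (a₁² − a₂²)/(2ρ)`
    show s / 16 ≤ ((s / 2) ^ 2 - (s / 4) ^ 2) / (2 * s)
    rw [le_div_iff₀ (by positivity)]
    nlinarith
  · exact W.center_mem_innerCore hΨ0
  · exact W.center_mem_coreOpen hΨ0
  · exact fun k hk => hΨcar k (ball_subset_ball hsρ hk)
  · rintro _ ⟨k, hk, rfl⟩
    exact carrier_limitConeUnitChain_subset hA hb (hΨcar k (ball_subset_ball hsρ hk))
  · exact fun k hk => htan k (ball_subset_ball hsρ hk)

/-- **Windows of the tangent cone, packaged for the sheet-number files.** For `y ∈ M` with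
`‖y‖ < ρ₀ < 1`, a radius bound `R > 0`, and `ε > 0`, there are a chart window `W` centred at `y`
as in `exists_chartWindow_of_mem_limitConeReg` (almost-isometric chart, `dim_ℂ K = p`,
`τ ≤ (a₁² − a₂²)/(2ρ)`, closed tube in `𝐁(y, ε) ∩ 𝐁(0, ρ₀)`, `y` in the inner core, limit cone in
the tube `=` graph points) and `0 < r₀ ≤ R` such that the tube condition
`A_r⁻¹(reg|T|) ∩ closedTube ⊆ {‖w‖ < τ/16}` holds for all `0 < r < r₀` — the hypotheses of
`HolomorphicChain.exists_sheetNumber` and `HolomorphicChain.collapse_pushforward_corePiece`; and for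
every `η > 0` the finer condition `⊆ {‖w‖ < η}` holds for all small `r`.
[cite: Federer1969, 4.3.16–4.3.18; Harvey1977, Thm. 1.31] -/
theorem exists_chartWindow_sheets_of_mem_limitConeReg [MeasurableSpace V] [BorelSpace V] (T : HolomorphicChain 𝓘(ℂ, V) Ω p)
    (hA : HasPureDim 𝓘(ℂ, V) T.support p) {b : V} (hb : b ∈ (Ω : Set V)) {y : (⊤ : Opens V)}
    (hy : y ∈ limitConeReg T.support hb p) {ρ₀ : ℝ} (hρ₀ : ρ₀ < 1) (hyρ₀ : ‖(y : V)‖ < ρ₀)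
    {R : ℝ} (hR : 0 < R) {ε : ℝ} (hε : 0 < ε) :
    ∃ W : ChartWindow V, W.m = y ∧ finrank ℂ W.K = p ∧ W.Ψ 0 = y ∧
      fderiv ℂ W.Ψ 0 = W.K.subtypeL ∧
      (∀ k ∈ ball (0 : W.K) W.ρ, ‖fderiv ℂ W.Ψ k - W.K.subtypeL‖ ≤ 1 / 2) ∧
      (∀ k ∈ ball (0 : W.K) W.ρ, ‖fderiv ℂ W.Ψ k‖ ≤ 2) ∧
      W.τ ≤ (W.a₁ ^ 2 - W.a₂ ^ 2) / (2 * W.ρ) ∧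
      W.closedTube ⊆ closedBall (y : V) ε ∧ W.closedTube ⊆ closedBall (0 : V) ρ₀ ∧
      (y : V) ∈ W.innerCore ∧ (y : V) ∈ W.coreOpen ∧
      (∀ k ∈ ball (0 : W.K) W.ρ, W.Ψ k ∈ (limitConeUnitChain hA hb).carrier) ∧
      W.Ψ '' ball (0 : W.K) W.ρ ⊆ limitCone T.support hb ∧
      (∀ k ∈ ball (0 : W.K) W.ρ,
        approxTangentCone (2 * p) ((μHE[2 * p] : Measure V).restrict
          (limitConeUnitChain hA hb).carrier) (W.Ψ k) = Set.range (fderiv ℂ W.Ψ k)) ∧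
      limitCone T.support hb ∩ W.closedTube ⊆ W.Ψ '' ball (0 : W.K) W.ρ ∧
      (∀ x ∈ limitCone T.support hb ∩ W.closedTube, W.wf x = 0) ∧
      (∀ η : ℝ, 0 < η →
        ∀ᶠ r in 𝓝[>] (0 : ℝ), T.blowUpSet b r ∩ W.closedTube ⊆ {x | ‖W.wf x‖ < η}) ∧
      ∃ r₀ : ℝ, 0 < r₀ ∧ r₀ ≤ R ∧
        ∀ r ∈ Ioo 0 r₀, T.blowUpSet b r ∩ W.closedTube ⊆ {x | ‖W.wf x‖ < W.τ / 16} := by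
  -- a window inside `𝐁(y, ε') ⊆ 𝐁(0, ρ₀)`, `ε' = min ε (ρ₀ − ‖y‖)`
  have hε' : 0 < min ε (ρ₀ - ‖(y : V)‖) := lt_min hε (by linarith)
  obtain ⟨W, hm, hKp, hΨ0, hDΨ, hD, hM, -, -, -, -, hτ, htube, hinn, hcore, hcar, hΨF, htan,
    hFW, hFW0⟩ := T.exists_chartWindow_of_mem_limitConeReg hA hb hy hε'
  have htubeε : W.closedTube ⊆ closedBall (y : V) ε :=
    htube.trans (closedBall_subset_closedBall (min_le_left _ _))
  have htube₀ : W.closedTube ⊆ closedBall (0 : V) ρ₀ := by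
    intro x hx
    have h1 : ‖x - (y : V)‖ ≤ ρ₀ - ‖(y : V)‖ := by
      have := htube hx
      rw [mem_closedBall, dist_eq_norm] at this
      exact this.trans (min_le_right _ _)
    rw [mem_closedBall, dist_zero_right]
    calc ‖x‖ = ‖(x - (y : V)) + (y : V)‖ := by rw [sub_add_cancel]
      _ ≤ ‖x - (y : V)‖ + ‖(y : V)‖ := norm_add_le _ _
      _ ≤ ρ₀ := by linarith
  have htube₁ : W.closedTube ⊆ closedBall (0 : V) 1 :=
    htube₀.trans (closedBall_subset_closedBall hρ₀.le)
  obtain ⟨r₀, hr₀, hr₀R, hsheets⟩ :=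
    T.exists_forall_Ioo_blowUpSet_inter_closedTube_subset_of_lt hb W htube₁ hFW0 hR
  exact ⟨W, hm, hKp, hΨ0, hDΨ, hD, hM, hτ, htubeε, htube₀, hinn, hcore, hcar, hΨF, htan, hFW, hFW0,
    fun η hη => T.eventually_blowUpSet_inter_closedTube_subset hb W htube₁ hFW0 hη,
    r₀, hr₀, hr₀R, hsheets⟩

end HolomorphicChain

end Literature.Geometry.Kaehler
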